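import Mathlib
import Literature.RingTheory.CohomologyAnnihilator.NoetherDifferentAnnihilator
import Literature.RingTheory.CohomologyAnnihilator.RegularRing
import Summits.ResolutionOfSingularities.ResolutionOfSingularities.Theorems.HomologicalConductorPersistenceEtaleAscent
import Summits.ResolutionOfSingularities.ResolutionOfSingularities.Theorems.HomologicalConductorPersistenceFrobeniusOrderSyzygy
import HarnessLib

/-!
# Rung S-2 `PersistenceSurface` (stmt-ResolutionOfSingularities-19970), crux `Persistence` (16484) —
# the NOETHER-DIFFERENT FLOOR: Frobenius («Casimir») different elements are cohomology annihilators

Route `ResolutionOfSingularities/HomologicalConductor`.  OURS (cell res-hironaka, chain w44b, seat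
res-L1-w44b-idea-2 gen 8, technique B «Jacobian / Lipman–Sathaye persistence + computed charts»);
nothing here is a statement of the manuscript under review (Hironaka 2017); AI-written, weaker than
expert review.

The chain's exponent-free KEPT engines at a stage `T' = T_{m+1}` of a `ca`-tower are FLOORS
`F(T') ⊆ ca(T')` into which the exceptional equation `x` must fall.  So far the floor in use was the
JACOBIAN (Kähler different; tree `PersistenceJacobianKept`, `PersistenceHypersurfaceJacobian`, the
Bezoutian files), which at non-complete-intersection stages is much smaller than the NOETHER different:
at the elliptic sextic cone `T₁(Ẽ₇)` the Jacobian is `𝔪⁴` while `x ∈ 𝔪² ∖ 𝔪³` (stub-4 SIGMA6b §7),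
but the noether differents of the linear pencils already span `𝔪² = ca(T₁)` (idea-2 g8 memo
`S2-WAHL-FLOOR.md`, machine check E1).  This file supplies the two formal facts that turn such a
computation into a certificate:

* **`casimir_mem_noetherDifferent`** — for an `A`-algebra `B` with an `A`-linear form `τ : B → A` and
  finite families `s, s'` that are DUAL BASES for `τ` in the weak sense `u = Σⱼ τ(u sⱼ) s'ⱼ = Σⱼ τ(u s'ⱼ) sⱼ`
  for all `u` (a free FROBENIUS extension), the Casimir element `Σᵢ s'ᵢ ⊗ sᵢ` centralises `B ⊗_A B`
  (this is EXACTLY the tree's `FrobeniusOrderSyzygy.casimir`, res-D-pv-037 p530841, which we reuse),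
  hence **`θ := Σᵢ s'ᵢ sᵢ ∈ 𝔑(B/A)`** (E. Kunz, *Introduction to Plane Algebraic Curves* (2005), App. H,
  Cor. H.20: for an algebra with a trace `Δ_σ = Σ s'ᵢ ⊗ sᵢ` generates `Ann_{Sᵉ}(I)`, so
  `𝔑(S/R) = (Σ s'ᵢ sᵢ)` is principal; we prove only the membership, which is all a floor needs).
  `casimir_mem_noetherDifferent_of_basis` takes instead two `A`-bases with Gram matrix `τ(sᵢ s'ⱼ) = δᵢⱼ`
  (tree `FrobeniusOrderSyzygy.dualBases_of_basis`).  Compare res-D-pv-058's HIGMAN criterion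
  (`PersistenceFrobeniusHigman.stablyAnnihilates_iff_exists_casimir`): `θ = Tr(1)` is the `φ = 1` instance
  there; here it enters `ca` through the noether different and Iyengar–Takahashi instead, for ALL finitely
  generated modules and any `d`.
* **`noetherDifferent_le_cohomologyAnnihilatorOfDegree_of_projective`** — `B` module-finite and
  PROJECTIVE over noetherian `A` with `caᵈ⁺¹(A) = A` ⇒ `𝔑(B/A) ⊆ caᵈ⁺¹(B)` (Iyengar–Takahashi
  Prop. 3.4 with `I' = A`; one line from the tree's `PersistenceEtaleAscent` relative form), its versions
  for `A` regular of dimension `≤ d` and for a polynomial noether normalisation `k[X₁,…,X_d]`, the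
  **different floor** `⨆ᵢ 𝔑(B/Aᵢ) ⊆ caᵈ⁺¹(B)` over any family of such structures, and the combination
  `casimir_mem_cohomologyAnnihilatorOfDegree` : `Σᵢ s'ᵢ sᵢ ∈ caᵈ⁺¹(B)`.

References (mechanism only): S. B. Iyengar, R. Takahashi, arXiv:1404.1476, Prop. 3.4
[`IyengarTakahashi2014`]; E. Kunz, *Introduction to Plane Algebraic Curves*, Birkhäuser 2005, App. H,
H.19–H.20 [classical]; M. Auslander, O. Goldman, *The Brauer group of a commutative ring* (homological
different) [classical].  All `[folklore]` at the level used here.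
-/

noncomputable section

-- single-problem summit: the doubled namespace component `ResolutionOfSingularities` is forced
set_option linter.dupNamespace false

open Literature.RingTheory.CohomologyAnnihilator
open Summit.ResolutionOfSingularities.ResolutionOfSingularities.Theorems.HomologicalConductor
open scoped TensorProduct

universe u

namespace Summit.ResolutionOfSingularities.ResolutionOfSingularities.Theorems.HomologicalConductor.PersistenceFrobeniusDifferent

section Casimir

variable {A : Type u} [CommRing A] {B : Type u} [CommRing B] [Algebra A B]
variable {ι : Type} [Fintype ι]

/-- **Frobenius different element.** If `u = Σⱼ τ(u sⱼ) s'ⱼ` and `u = Σⱼ τ(u s'ⱼ) sⱼ` for all `u ∈ B`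
(weak dual bases for the `A`-linear form `τ`), then `θ = Σᵢ s'ᵢ sᵢ` lies in the noether different
`𝔑(B/A)`: the Casimir `Σᵢ s'ᵢ ⊗ sᵢ` centralises (tree `FrobeniusOrderSyzygy.casimir`) and `μ` of it is
`θ`. [folklore] (Kunz, App. H, Cor. H.20: for a free algebra with a trace `𝔑(B/A) = (θ)`.) -/
theorem casimir_mem_noetherDifferent (τ : B →ₗ[A] A) (s s' : ι → B)
    (h1 : ∀ u : B, ∑ j, τ (u * s j) • s' j = u) (h2 : ∀ u : B, ∑ j, τ (u * s' j) • s j = u) :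
    ∑ i, s' i * s i ∈ noetherDifferent A B := by
  refine ⟨∑ i, s' i ⊗ₜ[A] s i, fun b => ?_, ?_⟩
  · rw [Finset.mul_sum, Finset.mul_sum]
    have hc := FrobeniusOrderSyzygy.casimir (τ := τ) (b := s) (bd := s') h2 h1 b
    calc ∑ i, (b ⊗ₜ[A] (1 : B)) * (s' i ⊗ₜ[A] s i)
        = ∑ i, (b * s' i) ⊗ₜ[A] s i := Finset.sum_congr rfl fun i _ => by
          rw [Algebra.TensorProduct.tmul_mul_tmul, one_mul]
      _ = ∑ i, s' i ⊗ₜ[A] (s i * b) := hc.symm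
      _ = ∑ i, ((1 : B) ⊗ₜ[A] b) * (s' i ⊗ₜ[A] s i) := Finset.sum_congr rfl fun i _ => by
          rw [Algebra.TensorProduct.tmul_mul_tmul, one_mul, mul_comm b]
  · rw [map_sum]
    exact Finset.sum_congr rfl fun i _ => Algebra.TensorProduct.lmul'_apply_tmul _ _

/-- **Frobenius different element from dual bases.** If `s` and `s'` are `A`-bases of `B` with Gram
matrix `τ(sᵢ s'ⱼ) = δᵢⱼ` for an `A`-linear form `τ`, then `Σᵢ s'ᵢ sᵢ ∈ 𝔑(B/A)` (tree
`FrobeniusOrderSyzygy.dualBases_of_basis` supplies the two expansions). [folklore] (Kunz H.20) -/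
theorem casimir_mem_noetherDifferent_of_basis [DecidableEq ι] (τ : B →ₗ[A] A)
    (bs bs' : Module.Basis ι A B) (hG : ∀ i j, τ (bs i * bs' j) = if i = j then 1 else 0) :
    ∑ i, bs' i * bs i ∈ noetherDifferent A B := by
  obtain ⟨h2, h1⟩ := FrobeniusOrderSyzygy.dualBases_of_basis (τ := τ) bs bs' hG
  exact casimir_mem_noetherDifferent τ bs bs' h1 h2

end Casimir

section Floor

variable {A : Type u} [CommRing A] {B : Type u} [CommRing B] [Algebra A B]

/-- **Iyengar–Takahashi Prop. 3.4 for a projective algebra, floor form (OURS).** `B` module-finite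
and projective over the noetherian ring `A` with `caᵈ⁺¹(A) = A` ⇒ `𝔑(B/A) ⊆ caᵈ⁺¹(B)`.
[OURS · L1 w44b] -/
theorem noetherDifferent_le_cohomologyAnnihilatorOfDegree_of_projective [IsNoetherianRing A]
    [Module.Finite A B] [Module.Projective A B] {d : ℕ}
    (hvan : cohomologyAnnihilatorOfDegree A (d + 1) = ⊤) :
    noetherDifferent A B ≤ cohomologyAnnihilatorOfDegree B (d + 1) := by
  intro x hx
  have h := PersistenceEtaleAscent.noetherDifferent_mul_mem_cohomologyAnnihilatorOfDegree_of_projective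
    (A := A) (B := B) (d := d) hx (c := 1) (by rw [hvan]; exact Submodule.mem_top)
  rwa [map_one, mul_one] at h

/-- The same over a REGULAR noetherian base of Krull dimension `≤ d` (`caᵈ⁺¹(A) = A`, tree
`cohomologyAnnihilatorOfDegree_eq_top_of_isRegularRing`). [OURS · L1 w44b] -/
theorem noetherDifferent_le_cohomologyAnnihilatorOfDegree_of_isRegularRing
    [IsRegularRing A] [Module.Finite A B] [Module.Projective A B] {d : ℕ} (hdim : ringKrullDim A ≤ d) :
    noetherDifferent A B ≤ cohomologyAnnihilatorOfDegree B (d + 1) :=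
  noetherDifferent_le_cohomologyAnnihilatorOfDegree_of_projective
    (cohomologyAnnihilatorOfDegree_eq_top_of_isRegularRing A hdim)

/-- The same for a polynomial noether normalisation `k[X₁,…,X_d] → B` with `B` module-finite and
projective (e.g. a Cohen–Macaulay graded `B` free over a homogeneous system of parameters).
[OURS · L1 w44b] -/
theorem noetherDifferent_mvPolynomial_le_cohomologyAnnihilatorOfDegree (k : Type u) [Field k] (d : ℕ)
    {B : Type u} [CommRing B] [Algebra (MvPolynomial (Fin d) k) B]
    [Module.Finite (MvPolynomial (Fin d) k) B] [Module.Projective (MvPolynomial (Fin d) k) B] :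
    noetherDifferent (MvPolynomial (Fin d) k) B ≤ cohomologyAnnihilatorOfDegree B (d + 1) := by
  refine noetherDifferent_le_cohomologyAnnihilatorOfDegree_of_isRegularRing (le_of_eq ?_)
  rw [MvPolynomial.ringKrullDim_of_isNoetherianRing, ringKrullDim_eq_zero_of_field, zero_add,
    Nat.card_eq_fintype_card, Fintype.card_fin]

/-- **The different floor (OURS).** For any family of algebra structures `Aᵢ → B` (e.g. all noether
normalisations / pencils of a graded ring) with `B` module-finite projective over each `Aᵢ` and
`caᵈ⁺¹(Aᵢ) = Aᵢ`: `⨆ᵢ 𝔑(B/Aᵢ) ⊆ caᵈ⁺¹(B)`. [OURS · L1 w44b] -/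
theorem iSup_noetherDifferent_le_cohomologyAnnihilatorOfDegree {κ : Type*} (R : κ → Type u)
    [∀ i, CommRing (R i)] [∀ i, Algebra (R i) B] [∀ i, IsNoetherianRing (R i)]
    [∀ i, Module.Finite (R i) B] [∀ i, Module.Projective (R i) B] {d : ℕ}
    (hvan : ∀ i, cohomologyAnnihilatorOfDegree (R i) (d + 1) = ⊤) :
    ⨆ i, noetherDifferent (R i) B ≤ cohomologyAnnihilatorOfDegree B (d + 1) :=
  iSup_le fun i => noetherDifferent_le_cohomologyAnnihilatorOfDegree_of_projective (hvan i)

/-- **Frobenius different elements are cohomology annihilators (OURS).** With `B` module-finite and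
projective over noetherian `A`, `caᵈ⁺¹(A) = A`, an `A`-linear form `τ` and weak dual bases `s, s'`:
`Σᵢ s'ᵢ sᵢ ∈ caᵈ⁺¹(B)` — the certificate behind the machine check E1 (elliptic sextic cone: the
Casimirs of 24 linear pencils span `𝔪² = ca`). [OURS · L1 w44b] -/
theorem casimir_mem_cohomologyAnnihilatorOfDegree [IsNoetherianRing A] [Module.Finite A B]
    [Module.Projective A B] {d : ℕ} (hvan : cohomologyAnnihilatorOfDegree A (d + 1) = ⊤)
    {ι : Type} [Fintype ι] (τ : B →ₗ[A] A) (s s' : ι → B)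
    (h1 : ∀ u : B, ∑ j, τ (u * s j) • s' j = u) (h2 : ∀ u : B, ∑ j, τ (u * s' j) • s j = u) :
    ∑ i, s' i * s i ∈ cohomologyAnnihilatorOfDegree B (d + 1) :=
  noetherDifferent_le_cohomologyAnnihilatorOfDegree_of_projective hvan
    (casimir_mem_noetherDifferent τ s s' h1 h2)

end Floor

end Summit.ResolutionOfSingularities.ResolutionOfSingularities.Theorems.HomologicalConductor.PersistenceFrobeniusDifferent

end
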